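import Summits.MatrixMultiplication.OmegaCensus.ThreeSetZ5Z5CoverKitE3
import HarnessLib

/-!
# Splitting the outer loops of the three-margin cover program (small kernel computations)

ω-census `pub-omega`, family (b3), seat pub-omega-group gen 37.  Framing: lottery ticket; floor = certified bounds/negative
ranges.  VALUE: bookkeeping for the `ℤ₅²` stage of the census cell `(1,9,12)@325` (design `HOME/pub-omega-group-g37/DESIGN-1-9-12.md`):
the measured kernel budget is ≈ one flagged row vector × 4–8 flagged column vectors × all flagged diagonal vectors per `decide`
(`|X| = 9`: ≈ 20–60 s; 32 columns at once exceed the kernel's memory cap), so both outer loops of `ZpZpDomino.coverGenE3` are split and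
the pieces recombined with `coverGenE3_append` (rows, in `ThreeSetZ5Z5CoverKitE3.lean`) and `coverGenE3_appendC` (columns, here);
NOT progress on ω.
-/

namespace Summit.MatrixMultiplication.OmegaCensus

namespace ZpZpDomino

/-- **Splitting the column list for a single row vector**: with `Rlist = [R]` and `R` flagged, the program over `C₁ ++ C₂` is the
conjunction of the programs over `C₁` and `C₂`. [folklore] -/
theorem coverGenE3_appendC (tree : BTree) (exc : List (List (List ℕ))) (B : ℕ) (ws : List (List (List ℕ))) (dss : List (List ℕ))
    (R : List ℕ) (C₁ C₂ Dlist : List (List ℕ)) (init : List ℕ) (offC offD : ℕ) (hR : tree.mem (polyBE B R) = true) :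
    coverGenE3 tree exc B ws dss [R] (C₁ ++ C₂) Dlist init offC offD =
      (coverGenE3 tree exc B ws dss [R] C₁ Dlist init offC offD && coverGenE3 tree exc B ws dss [R] C₂ Dlist init offC offD) := by
  simp [coverGenE3, List.all_append, hR]

/-- **Recombining a list of column chunks** for a single flagged row vector. [folklore] -/
theorem coverGenE3_of_chunks (tree : BTree) (exc : List (List (List ℕ))) (B : ℕ) (ws : List (List (List ℕ))) (dss : List (List ℕ))
    (R : List ℕ) (Dlist : List (List ℕ)) (init : List ℕ) (offC offD : ℕ) (hR : tree.mem (polyBE B R) = true) :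
    ∀ chunks : List (List (List ℕ)),
      (∀ C ∈ chunks, coverGenE3 tree exc B ws dss [R] C Dlist init offC offD = true) →
      coverGenE3 tree exc B ws dss [R] chunks.flatten Dlist init offC offD = true
  | [], _ => by simp [coverGenE3]
  | C :: cs, h => by
    rw [List.flatten_cons, coverGenE3_appendC tree exc B ws dss R C _ Dlist init offC offD hR, Bool.and_eq_true]
    exact ⟨h C (by simp), coverGenE3_of_chunks tree exc B ws dss R Dlist init offC offD hR cs fun C' hC' => h C' (by simp [hC'])⟩

end ZpZpDomino

end Summit.MatrixMultiplication.OmegaCensus
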